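import Mathlib.Analysis.InnerProductSpace.Projection.Reflection
import Mathlib.Analysis.Normed.Module.Connected
import Mathlib.Topology.LocallyConstant.Basic
import Literature.Geometry.DiscreteGeometry.KissingPatterns
import HarnessLib

/-!
# The one-shell flow vanishes: no direction-only discharging for the surface energy

HONEST FRAMING. Part of the venture `Summits/Ventures/Crystal3D` (cells `pub-crystal3d`,
`crystal3d-full`). A NO-GO lemma about a proof method; nothing here is about packings' ground
states or three-dimensional crystallization.

**Theorem** (`oneShellFlow_vanishes`; the statement `OneShellFlowVanishes` of
HOME/cf-p1/lean/WulffSelection.lean, ROUTE.md §12.3, with the cell's `IsKissingConfig U` written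
out:
unit vectors pairwise at distance `≥ 1`).  If an odd weight `w : ℝ³ → ℝ` is dominated by the
contact deficit at every kissing configuration, `∑_{u ∈ U} w u ≤ 12 − |U|`, then `w = 0` on the
unit sphere.

Proof (p1's sketch, with a rational icosahedron).  (1) For a TWELVE-point kissing configuration
`U`, `∑_U w ≤ 0` and, applying the hypothesis to `−U`, `∑_U w ≥ 0`; so `∑_U w = 0`.
(2) The twelve integer points `(0, ±5, ±8)`, `(±5, ±8, 0)`, `(±8, 0, ±5)` of squared norm `89`
(an almost regular icosahedron), scaled to the unit sphere, are pairwise at squared distance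
`≥ 98/89 > (26/25)²`: a kissing configuration with SLACK.  Replacing one point `x₁` by any unit
vector within `1/25` of it keeps a twelve-point kissing configuration, so `w` is constant on that
cap; transporting by the reflection taking `x₁` to an arbitrary unit vector (`reflection_sub`),
`w` is locally constant on the sphere, hence constant (the `2`-sphere is connected,
`isPreconnected_sphere`), hence `0` by oddness.

Consequence for the cell (ROUTE.md §12): a calibration/discharging proof of `SurfaceLiminf` must
weigh a bond by data of BOTH endpoint shells.

WHAT THIS IS NOT: not a statement about any particular packing; rung F-C1 not moved.
-/

noncomputable section

namespace Summit.Ventures.Crystal3D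

open Finset Metric
open Literature.Geometry.DiscreteGeometry

/-- Distances inside a scaled integer pattern: if distinct `v, w ∈ S` differ by squared norm
`≥ M`, then the corresponding points of `scaledPattern S N` are at distance `≥ √M / √N`. -/
theorem sqrt_div_le_dist_of_mem_scaledPattern {S : Finset (Fin 3 → ℤ)} {N M : ℕ} (hN : N ≠ 0)
    (hS : ∀ v ∈ S, ∀ w ∈ S, v ≠ w → (M : ℤ) ≤ sqNormInt (v - w))
    {x y : EuclideanSpace ℝ (Fin 3)} (hx : x ∈ scaledPattern S N) (hy : y ∈ scaledPattern S N)
    (hxy : x ≠ y) : Real.sqrt M / Real.sqrt N ≤ dist x y := by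
  obtain ⟨v, hv, rfl⟩ := Finset.mem_image.1 hx
  obtain ⟨w, hw, rfl⟩ := Finset.mem_image.1 hy
  have hvw : v ≠ w := fun h => hxy (by rw [h])
  have hpos : (0 : ℝ) < Real.sqrt N := by positivity
  have hle : Real.sqrt M ≤ Real.sqrt (sqNormInt (v - w) : ℝ) :=
    Real.sqrt_le_sqrt (by exact_mod_cast hS v hv w hw hvw)
  rw [dist_eq_norm, ← smul_sub, intVec_sub, norm_smul, norm_inv, Real.norm_of_nonneg hpos.le,
    norm_intVec, div_eq_inv_mul]
  exact mul_le_mul_of_nonneg_left hle (inv_nonneg.2 hpos.le)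

/-- **`OneShellFlowVanishes`.** An odd weight on `ℝ³` dominated by the contact deficit at every
kissing configuration (unit vectors pairwise at distance `≥ 1`) vanishes on the unit sphere. -/
theorem oneShellFlow_vanishes :
    ∀ w : EuclideanSpace ℝ (Fin 3) → ℝ, (∀ u, w (-u) = -w u) →
      (∀ U : Finset (EuclideanSpace ℝ (Fin 3)),
          ((∀ u ∈ U, ‖u‖ = 1) ∧ ∀ u ∈ U, ∀ v ∈ U, u ≠ v → (1 : ℝ) ≤ dist u v) →
            ∑ u ∈ U, w u ≤ 12 - (U.card : ℝ)) →
        ∀ u : EuclideanSpace ℝ (Fin 3), ‖u‖ = 1 → w u = 0 := by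
  classical
  intro w hodd hdom
  -- (1) twelve-point kissing configurations have total weight zero
  have hzero : ∀ U : Finset (EuclideanSpace ℝ (Fin 3)), (∀ u ∈ U, ‖u‖ = 1) →
      (∀ u ∈ U, ∀ v ∈ U, u ≠ v → (1 : ℝ) ≤ dist u v) → U.card = 12 → ∑ u ∈ U, w u = 0 := by
    intro U hn hsep hcard
    have h1 := hdom U ⟨hn, hsep⟩
    rw [hcard] at h1
    have h2 := hdom (U.image fun u => -u) ⟨fun u hu => ?_, fun u hu v hv huv => ?_⟩
    · rw [card_image_of_injective _ neg_injective, hcard,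
        sum_image fun a _ b _ h => neg_injective h] at h2
      simp only [hodd, sum_neg_distrib] at h2
      push_cast at h1 h2
      linarith
    · obtain ⟨u', hu', rfl⟩ := mem_image.1 hu
      rw [norm_neg]; exact hn u' hu'
    · obtain ⟨u', hu', rfl⟩ := mem_image.1 hu
      obtain ⟨v', hv', rfl⟩ := mem_image.1 hv
      rw [dist_neg_neg]
      exact hsep u' hu' v' hv' fun h => huv (by rw [h])
  -- (2) a kissing configuration with slack: the integer icosahedron of squared norm 89
  set I : Finset (Fin 3 → ℤ) := {![0, 5, 8], ![0, 5, -8], ![0, -5, 8], ![0, -5, -8],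
    ![5, 8, 0], ![5, -8, 0], ![-5, 8, 0], ![-5, -8, 0],
    ![8, 0, 5], ![8, 0, -5], ![-8, 0, 5], ![-8, 0, -5]} with hI
  have hIcard : I.card = 12 := by rw [hI]; decide
  have hInorm : ∀ v ∈ I, sqNormInt v = (89 : ℕ) := by rw [hI]; decide
  have hIsep : ∀ v ∈ I, ∀ v' ∈ I, v ≠ v' → ((98 : ℕ) : ℤ) ≤ sqNormInt (v - v') := by
    rw [hI]; decide
  set U₀ : Finset (EuclideanSpace ℝ (Fin 3)) := scaledPattern I 89 with hU₀
  have hU₀card : U₀.card = 12 := by rw [hU₀, card_scaledPattern _ (by norm_num), hIcard]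
  have hU₀norm : ∀ u ∈ U₀, ‖u‖ = 1 := fun u hu =>
    norm_eq_one_of_mem_scaledPattern (by norm_num) hInorm hu
  -- the slack: pairwise distances `≥ √98/√89 ≥ 1 + 1/25`
  have hslack : (1 : ℝ) + 1 / 25 ≤ Real.sqrt (98 : ℕ) / Real.sqrt (89 : ℕ) := by
    rw [← Real.sqrt_div' _ (by norm_num)]
    have h0 : (0 : ℝ) ≤ ((98 : ℕ) : ℝ) / ((89 : ℕ) : ℝ) := by positivity
    nlinarith [Real.sq_sqrt h0, Real.sqrt_nonneg (((98 : ℕ) : ℝ) / ((89 : ℕ) : ℝ))]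
  have hU₀sep : ∀ u ∈ U₀, ∀ v ∈ U₀, u ≠ v → (1 : ℝ) + 1 / 25 ≤ dist u v := fun u hu v hv huv =>
    hslack.trans (sqrt_div_le_dist_of_mem_scaledPattern (by norm_num) hIsep hu hv huv)
  -- a point of the configuration
  set x₁ : EuclideanSpace ℝ (Fin 3) := (Real.sqrt (89 : ℕ))⁻¹ • intVec ![0, 5, 8] with hx₁
  have hx₁U : x₁ ∈ U₀ := by
    rw [hU₀, scaledPattern]; exact mem_image_of_mem _ (by rw [hI]; simp)
  have hx₁norm : ‖x₁‖ = 1 := hU₀norm x₁ hx₁U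
  -- (3) `w` is constant on the cap of radius `1/25` about `A x₁`, for every isometry `A`
  have hcap : ∀ (A : EuclideanSpace ℝ (Fin 3) ≃ₗᵢ[ℝ] EuclideanSpace ℝ (Fin 3))
      (u' : EuclideanSpace ℝ (Fin 3)), ‖u'‖ = 1 → dist u' (A x₁) < 1 / 25 → w u' = w (A x₁) := by
    intro A u' hu' hd
    have hAdist : ∀ y z : EuclideanSpace ℝ (Fin 3), dist (A y) (A z) = dist y z := fun y z => by
      rw [dist_eq_norm, dist_eq_norm, ← map_sub, A.norm_map]
    set U₁ := U₀.erase x₁ with hU₁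
    have hU₁card : U₁.card = 11 := by rw [hU₁, card_erase_of_mem hx₁U, hU₀card]
    -- the transported configuration
    have hV₀ : ∑ u ∈ U₀.image A, w u = 0 := by
      refine hzero _ (fun u hu => ?_) (fun u hu v hv huv => ?_) ?_
      · obtain ⟨y, hy, rfl⟩ := mem_image.1 hu
        rw [A.norm_map]; exact hU₀norm y hy
      · obtain ⟨y, hy, rfl⟩ := mem_image.1 hu
        obtain ⟨z, hz, rfl⟩ := mem_image.1 hv
        rw [hAdist]
        linarith [hU₀sep y hy z hz fun h => huv (by rw [h])]
      · rw [card_image_of_injective _ A.injective, hU₀card]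
    rw [sum_image fun a _ b _ h => A.injective h, ← add_sum_erase _ _ hx₁U] at hV₀
    -- the perturbed configuration
    have hu'not : u' ∉ U₁.image A := by
      intro hmem
      obtain ⟨y, hy, hyu⟩ := mem_image.1 hmem
      have hy₀ : y ∈ U₀ := mem_of_mem_erase hy
      have hyx : y ≠ x₁ := ne_of_mem_erase hy
      have := hU₀sep y hy₀ x₁ hx₁U hyx
      rw [← hAdist, hyu] at this
      linarith
    have hV : ∑ u ∈ insert u' (U₁.image A), w u = 0 := by
      refine hzero _ (fun u hu => ?_) (fun u hu v hv huv => ?_) ?_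
      · rcases mem_insert.1 hu with rfl | hu
        · exact hu'
        · obtain ⟨y, hy, rfl⟩ := mem_image.1 hu
          rw [A.norm_map]; exact hU₀norm y (mem_of_mem_erase hy)
      · rcases mem_insert.1 hu with rfl | hu₁ <;> rcases mem_insert.1 hv with rfl | hv₁
        · exact absurd rfl huv
        · obtain ⟨z, hz, rfl⟩ := mem_image.1 hv₁
          have h1 := hU₀sep x₁ hx₁U z (mem_of_mem_erase hz) (ne_of_mem_erase hz).symm
          rw [← hAdist] at h1
          have h2 := dist_triangle (A x₁) u (A z)
          rw [dist_comm] at hd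
          linarith
        · obtain ⟨y, hy, rfl⟩ := mem_image.1 hu₁
          have h1 := hU₀sep x₁ hx₁U y (mem_of_mem_erase hy) (ne_of_mem_erase hy).symm
          rw [← hAdist] at h1
          have h2 := dist_triangle (A x₁) v (A y)
          rw [dist_comm] at hd
          rw [dist_comm]
          linarith
        · obtain ⟨y, hy, rfl⟩ := mem_image.1 hu₁
          obtain ⟨z, hz, rfl⟩ := mem_image.1 hv₁
          rw [hAdist]
          linarith [hU₀sep y (mem_of_mem_erase hy) z (mem_of_mem_erase hz) fun h => huv (by rw [h])]
      · rw [card_insert_of_notMem hu'not, card_image_of_injective _ A.injective, hU₁card]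
    rw [sum_insert hu'not, sum_image fun a _ b _ h => A.injective h] at hV
    linarith
  -- (4) `w` is locally constant on the unit sphere, hence constant
  have hloc : ∀ v : EuclideanSpace ℝ (Fin 3), ‖v‖ = 1 → ∀ u', ‖u'‖ = 1 →
      dist u' v < 1 / 25 → w u' = w v := by
    intro v hv u' hu' hd
    set A := Submodule.reflection (ℝ ∙ (x₁ - v))ᗮ with hA
    have hAx : A x₁ = v := by rw [hA]; exact Submodule.reflection_sub (by rw [hx₁norm, hv])
    have := hcap A u' hu' (by rw [hAx]; exact hd)
    rw [hAx] at this
    exact this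
  have hrank : 1 < Module.rank ℝ (EuclideanSpace ℝ (Fin 3)) := by
    rw [← Module.finrank_eq_rank, finrank_euclideanSpace, Fintype.card_fin]
    norm_num
  have hpre : IsPreconnected (sphere (0 : EuclideanSpace ℝ (Fin 3)) 1) :=
    isPreconnected_sphere hrank 0 1
  haveI : PreconnectedSpace (sphere (0 : EuclideanSpace ℝ (Fin 3)) 1) :=
    Subtype.preconnectedSpace hpre
  set f : sphere (0 : EuclideanSpace ℝ (Fin 3)) 1 → ℝ := fun p => w p with hf
  have hflc : IsLocallyConstant f := by
    rw [IsLocallyConstant.iff_eventually_eq]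
    intro p
    rw [Metric.eventually_nhds_iff]
    refine ⟨1 / 25, by norm_num, fun q hq => ?_⟩
    have hp : ‖(p : EuclideanSpace ℝ (Fin 3))‖ = 1 := by simp
    have hq' : ‖(q : EuclideanSpace ℝ (Fin 3))‖ = 1 := by simp
    exact hloc p hp q hq' hq
  -- (5) constant and odd, hence zero
  intro u hu
  have hneg : ‖-u‖ = 1 := by rw [norm_neg, hu]
  have h := hflc.apply_eq_of_preconnectedSpace (⟨u, by simpa using hu⟩ : sphere _ 1)
    ⟨-u, by simpa using hneg⟩
  simp only [hf] at h
  rw [hodd] at h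
  linarith

end Summit.Ventures.Crystal3D

end
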